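import Literature.Probability.RandomPlanarGeometry.SLEThrPieceMartingales
import HarnessLib

/-!
# The through-swallow image chain of SLE₆: limits of the level-`n` piece increments

Sequel of `SLEThrPieceMartingales` (Lawler–Schramm–Werner (2001) Thm. 2.2 / G. F. Lawler (2005) §6.3
Thm. 6.13: gluing of the image driving martingales through the swallow instants). Theorems only, all
PATHWISE (a fixed sample `ω` satisfying the cluster dichotomy up to the horizon `H ω`):

* `Loewner.intervalIntegrable_imageClockRate_of_le_hullHitTime` — the capacity clock rate of a `*`-hull is
  integrable up to its contact time; `integrableOn_thrClockRate_of_clusterwise` — the through-swallow rate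
  is integrable up to the horizon (`Loewner.integrableOn_thrClockRate`);
* `pieceStart_lt_of_thrRho_lt`, `remHull_eq_pieceHull_of_mem_piece` — inside the piece of `s` the remaining
  hull is the piece hull `A ∖ ⋃ s`;
* `tendsto_pieceMart_of_mem_piece` — on the closed piece `[ρ_s, σ_s]` the level-`n` piece martingale tends to
  `X + L_{B_s}` (`X = thrDrv`, the through-swallow driving process minus `L_A`) and the piece clock to the
  capacity clock of the piece hull (eventually constant at alive times; at the contact time by
  `tendsto_pieceMart_of_hullHitTime_eq`);
* `tendsto_pieceIncr`, `tendsto_stoppedValue_pieceMart_thrRho`, `thrClock_sub_eq_imageClock_sub`,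
  `tendsto_pieceClockIncr` — the piece increments of the martingales and of the clocks converge to the
  increments of `X` and of the through-swallow clock `thrClock` over `[t ∧ ρ_s, t ∧ σ_s]`.

## References

* G. F. Lawler, O. Schramm, W. Werner, Acta Math. **187** (2001), Thm. 2.2. [LawlerSchrammWerner2001]
* G. F. Lawler (2005), §6.3 Thm. 6.13, Prop. 4.41. [Lawler2005]
-/

noncomputable section

open Set Filter Metric Function MeasureTheory
open _root_.Complex _root_.Topology
open scoped NNReal

namespace Literature.Probability.RandomPlanarGeometry

open Loewner

variable {κ : ℝ≥0} {A : Set ℂ} {hA : IsStarHull A} {δ : ℝ} {hδ : 0 < δ} {H : (ℝ≥0 → ℝ) → WithTop ℝ≥0}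

/-! ### Integrability of the clock rates -/

/-- **The capacity clock rate of a `*`-hull (possibly empty) is interval integrable on `[0, u]` for every
`u ≤ T_B`**: it is continuous on the alive times `[0, T_B)` and bounded by `1`. [folklore] -/
theorem Loewner.intervalIntegrable_imageClockRate_of_le_hullHitTime {W : ℝ≥0 → ℝ} (hW : Continuous W) {B : Set ℂ}
    (hB : IsStarHull B) {u : ℝ≥0} (hu : (u : WithTop ℝ≥0) ≤ hullHitTime W B) :
    IntervalIntegrable (imageClockRate W B) volume 0 u := by
  have halive : ∀ r ∈ Ico (0 : ℝ) u, Disjoint (closedHull W r.toNNReal) B := fun r hr ↦ by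
    refine disjoint_closedHull_of_lt_hullHitTime (lt_of_lt_of_le ?_ hu)
    have : r.toNNReal < u := by rw [← NNReal.coe_lt_coe, Real.coe_toNNReal _ hr.1]; exact hr.2
    exact_mod_cast this
  have hcont : ContinuousOn (imageClockRate W B) (Ico (0 : ℝ) u) := by
    intro r hr
    have h1 := continuousWithinAt_starDeriv_slidHull' hW hB (halive r hr)
    have h2 : ContinuousWithinAt (fun r' : ℝ ↦ starDeriv (slidHull W B r'.toNNReal)) (Ico (0 : ℝ) u) r :=
      h1.comp continuous_real_toNNReal.continuousWithinAt fun r' hr' ↦ halive r' hr'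
    exact h2.pow 2
  have hIco : IntegrableOn (imageClockRate W B) (Ico (0 : ℝ) u) volume := by
    refine Integrable.mono' (integrableOn_const (measure_Ico_lt_top (a := (0 : ℝ)) (b := (u : ℝ))).ne (C := (1 : ℝ)))
      (hcont.aestronglyMeasurable measurableSet_Ico) ?_
    filter_upwards with r
    rw [Real.norm_eq_abs, abs_of_pos (imageClockRate_pos_le_one W B r).1]
    exact (imageClockRate_pos_le_one W B r).2
  rw [intervalIntegrable_iff_integrableOn_Icc_of_le u.coe_nonneg, integrableOn_Icc_iff_integrableOn_Ico]
  exact hIco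

/-- Under the cluster dichotomy up to a finite horizon `h`, the remaining hull is closed on `[0, h]` and takes
finitely many values there, so the through-swallow clock rate is integrable on `[0, h]`
(`Loewner.integrableOn_thrClockRate`). [folklore] -/
theorem integrableOn_thrClockRate_of_clusterwise (hA : IsStarHull A) (hδ : 0 < δ) {ω : ℝ≥0 → ℝ} {h : ℝ≥0}
    (hclw : ∀ t : ℝ≥0, t ≤ h → ∀ a ∈ A, deltaCluster A δ a ⊆ closedHull (drvK κ (brownianCPath ω)) t ∨
      Disjoint (deltaCluster A δ a) (closedHull (drvK κ (brownianCPath ω)) t)) :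
    IntegrableOn (thrClockRate (drvK κ (brownianCPath ω)) A) (Icc (0 : ℝ) h) := by
  have hWc := continuous_drvK κ (brownianCPath ω)
  refine integrableOn_thrClockRate hWc hA (fun t ht ↦ isClosed_remHull_of_clusterwise hWc hA hδ (hclw t ht)) ?_
  refine ((clusterFinset hA hδ).powerset.finite_toSet.image (pieceHull A)).subset ?_
  rintro _ ⟨t, ht, rfl⟩
  refine ⟨swallowedAt (drvK κ (brownianCPath ω)) (clusterFinset hA hδ) t, ?_, ?_⟩
  · exact Finset.mem_coe.2 (Finset.mem_powerset.2 (swallowedAt_subset _ _ _))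
  · exact (remHull_eq_pieceHull_swallowedAt hWc hA hδ (hclw t ht.2)).symm

/-! ### The piece processes inside their piece: limits as `n → ∞` -/

section Limits

variable {s : Finset (Set ℂ)} {ω : ℝ≥0 → ℝ}

/-- **Order structure of a nonempty piece**: if `ρ_s < σ_s` then `a_s < b_s`, `a_s < H` and `ρ_s = a_s`. [folklore] -/
theorem pieceStart_lt_of_thrRho_lt (hlt : thrRho κ hA hδ H s ω < thrSigma κ hA hδ H s ω) :
    pieceStart (drvK κ (brownianCPath ω)) s < pieceEnd (drvK κ (brownianCPath ω)) (clusterFinset hA hδ) s ∧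
      pieceStart (drvK κ (brownianCPath ω)) s < H ω ∧
      thrRho κ hA hδ H s ω = pieceStart (drvK κ (brownianCPath ω)) s := by
  set a := pieceStart (drvK κ (brownianCPath ω)) s
  set b := pieceEnd (drvK κ (brownianCPath ω)) (clusterFinset hA hδ) s
  have hab : a < b := by
    by_contra hba
    refine hlt.ne ?_
    show min (min a b) (H ω) = min b (H ω)
    rw [min_eq_right (not_lt.1 hba)]
  have hmin : min a b = a := min_eq_left hab.le
  have hah : a < H ω := by
    by_contra hha
    refine hlt.not_ge ?_
    show min b (H ω) ≤ min (min a b) (H ω)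
    rw [hmin, min_eq_right (not_lt.1 hha)]
    exact min_le_right _ _
  refine ⟨hab, hah, ?_⟩
  show min (min a b) (H ω) = a
  rw [hmin, min_eq_left hah.le]

/-- **Inside its piece the remaining hull is the piece hull.** [folklore] -/
theorem remHull_eq_pieceHull_of_mem_piece (hs : s ⊆ clusterFinset hA hδ)
    (hclw : ∀ t : ℝ≥0, (t : WithTop ℝ≥0) ≤ H ω → ∀ a ∈ A, deltaCluster A δ a ⊆ closedHull (drvK κ (brownianCPath ω)) t ∨
      Disjoint (deltaCluster A δ a) (closedHull (drvK κ (brownianCPath ω)) t))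
    {v : ℝ≥0} (hav : pieceStart (drvK κ (brownianCPath ω)) s ≤ v)
    (hvb : (v : WithTop ℝ≥0) < pieceEnd (drvK κ (brownianCPath ω)) (clusterFinset hA hδ) s) (hvh : (v : WithTop ℝ≥0) ≤ H ω) :
    remHull (drvK κ (brownianCPath ω)) A v = pieceHull A s := by
  rw [remHull_eq_pieceHull_swallowedAt (continuous_drvK κ _) hA hδ (hclw v hvh), (pieceStart_le_and_lt_pieceEnd_iff hs).1 ⟨hav, hvb⟩]

/-- **Limits of the piece processes at a time of the closed piece `[ρ_s, σ_s]` (nonempty piece)**: the piece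
martingale tends to `X_u + L_{B_s}` (`X = thrDrv`, the through-swallow driving process minus `L_A`) and the
piece clock to the capacity clock of the piece hull — eventually constant at alive times of the piece hull,
by `tendsto_pieceMart_of_hullHitTime_eq` at its contact time `b_s`. [cite: Lawler2005, §6.3 Thm. 6.13] -/
theorem tendsto_pieceMart_of_mem_piece (hs : s ⊆ clusterFinset hA hδ)
    (hclw : ∀ t : ℝ≥0, (t : WithTop ℝ≥0) ≤ H ω → ∀ a ∈ A, deltaCluster A δ a ⊆ closedHull (drvK κ (brownianCPath ω)) t ∨
      Disjoint (deltaCluster A δ a) (closedHull (drvK κ (brownianCPath ω)) t))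
    (hlt : thrRho κ hA hδ H s ω < thrSigma κ hA hδ H s ω) {u : ℝ≥0} (hρu : thrRho κ hA hδ H s ω ≤ u)
    (huσ : (u : WithTop ℝ≥0) ≤ thrSigma κ hA hδ H s ω) :
    Tendsto (fun n ↦ pieceMart κ hA hδ s n u ω) atTop (𝓝 (thrDrv κ A u ω + (starShift (pieceHull A s)).re)) ∧
      Tendsto (fun n ↦ pieceClock κ hA hδ s n u ω) atTop (𝓝 (imageClock (drvK κ (brownianCPath ω)) (pieceHull A s) u)) := by
  obtain ⟨hab, hah, hρa⟩ := pieceStart_lt_of_thrRho_lt hlt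
  set W := drvK κ (brownianCPath ω) with hWdef
  have hWc : Continuous W := continuous_drvK κ _
  set a := pieceStart W s with hadef
  set b := pieceEnd W (clusterFinset hA hδ) s with hbdef
  set B := pieceHull A s with hBdef
  have hau : a ≤ u := hρa ▸ hρu
  have hub : (u : WithTop ℝ≥0) ≤ b := huσ.trans (min_le_left _ _)
  have huh : (u : WithTop ℝ≥0) ≤ H ω := huσ.trans (min_le_right _ _)
  have hbT : b = hullHitTime W B := pieceEnd_eq_hullHitTime hWc hA hδ hs
  rcases hub.lt_or_eq with hlt' | heq'
  · -- alive time of the piece hull: eventually constant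
    have halive : Disjoint (closedHull W u) B := disjoint_closedHull_of_lt_hullHitTime (hbT ▸ hlt')
    have hrem : remHull W A u = B := remHull_eq_pieceHull_of_mem_piece hs hclw hau hlt' huh
    have hval : thrDrv κ A u ω + (starShift B).re = imageDriver W B u := by
      rw [thrDrv, thrImageDriver_eq_imageDriver_remHull (rfl : remHull W A u = remHull W A u), hrem]; ring
    have hev := eventually_pieceMart_eq (κ := κ) hs halive
    exact ⟨(tendsto_const_nhds.congr' (hev.mono fun n hn ↦ (hval.trans hn.1.symm))),
      tendsto_const_nhds.congr' (hev.mono fun n hn ↦ hn.2.symm)⟩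
  · -- the contact time of the piece hull
    have hne : s ≠ clusterFinset hA hδ := by
      rintro rfl
      have : b = ⊤ := by rw [hbdef, pieceEnd, Finset.sdiff_self, Finset.inf_empty]
      rw [this] at heq'; exact WithTop.coe_ne_top heq'
    have hT : hullHitTime W B = u := by rw [← hbT, heq']
    obtain ⟨a', ha'⟩ := WithTop.ne_top_iff_exists.1 hab.ne_top
    have ha'u : a' ≤ u := by have := hau; rw [← ha'] at this; exact WithTop.coe_le_coe.1 this
    have ha'h : ((a' : ℝ≥0) : WithTop ℝ≥0) ≤ H ω := by rw [ha']; exact hah.le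
    have hrem : remHull W A u = B \ closedHull W u :=
      remHull_eq_pieceHull_diff hWc hA hδ hs (by rw [← hadef, ← ha']) ha'u (hclw a' ha'h)
    have hcl : IsClosed (B \ closedHull W u) := hrem ▸ isClosed_remHull_of_clusterwise hWc hA hδ (hclw u huh)
    have hint := intervalIntegrable_imageClockRate_of_le_hullHitTime hWc (isStarHull_pieceHull hA hδ hs) (u := u) (by rw [hT])
    have h := tendsto_pieceMart_of_hullHitTime_eq (κ := κ) hs hne hT hcl hint
    have hval : thrDrv κ A u ω + (starShift B).re =
        W u + (starShift B).re - (starShift (slidHull W (B \ closedHull W u) u)).re := by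
      rw [thrDrv, thrImageDriver, thrSlidHull, hrem]; ring
    rw [hval]
    exact h

/-- **The piece increment converges to the increment of the stopped through-swallow driving process**:
`G^{s,n}_t → X_{t ∧ σ_s} − X_{t ∧ ρ_s}`. [cite: Lawler2005, §6.3 Thm. 6.13] -/
theorem tendsto_pieceIncr (hs : s ⊆ clusterFinset hA hδ)
    (hclw : ∀ t : ℝ≥0, (t : WithTop ℝ≥0) ≤ H ω → ∀ a ∈ A, deltaCluster A δ a ⊆ closedHull (drvK κ (brownianCPath ω)) t ∨
      Disjoint (deltaCluster A δ a) (closedHull (drvK κ (brownianCPath ω)) t)) (t : ℝ≥0) :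
    Tendsto (fun n ↦ pieceIncr κ hA hδ H s n t ω) atTop
      (𝓝 (stoppedProcess (thrDrv κ A) (thrSigma κ hA hδ H s) t ω - stoppedProcess (thrDrv κ A) (thrRho κ hA hδ H s) t ω)) := by
  rcases (thrRho_le_thrSigma (κ := κ) (hA := hA) (hδ := hδ) (H := H) s ω).eq_or_lt with heq | hlt
  · have h1 : ∀ n, pieceIncr κ hA hδ H s n t ω = 0 := fun n ↦ by simp only [pieceIncr, stoppedProcess, heq, sub_self]
    have h2 : stoppedProcess (thrDrv κ A) (thrSigma κ hA hδ H s) t ω - stoppedProcess (thrDrv κ A) (thrRho κ hA hδ H s) t ω = 0 := by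
      simp only [stoppedProcess, heq, sub_self]
    simp only [h1, h2]; exact tendsto_const_nhds
  rcases le_or_gt (t : WithTop ℝ≥0) (thrRho κ hA hδ H s ω) with htρ | hρt
  · have htσ : (t : WithTop ℝ≥0) ≤ thrSigma κ hA hδ H s ω := htρ.trans hlt.le
    have h1 : ∀ n, pieceIncr κ hA hδ H s n t ω = 0 := fun n ↦ by
      simp only [pieceIncr, stoppedProcess_eq_of_le htρ, stoppedProcess_eq_of_le htσ, sub_self]
    simp only [h1, stoppedProcess_eq_of_le htρ, stoppedProcess_eq_of_le htσ, sub_self]; exact tendsto_const_nhds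
  · obtain ⟨ρ', hρ'⟩ := WithTop.ne_top_iff_exists.1 hρt.ne_top
    set u : ℝ≥0 := (min (t : WithTop ℝ≥0) (thrSigma κ hA hδ H s ω)).untopA with hudef
    have hucoe : (u : WithTop ℝ≥0) = min (t : WithTop ℝ≥0) (thrSigma κ hA hδ H s ω) :=
      Literature.Analysis.FunctionSpaces.coe_untopA_min _ _
    have hρu : thrRho κ hA hδ H s ω ≤ u := by rw [hucoe]; exact le_min hρt.le hlt.le
    have huσ : (u : WithTop ℝ≥0) ≤ thrSigma κ hA hδ H s ω := by rw [hucoe]; exact min_le_right _ _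
    have hρρ : thrRho κ hA hδ H s ω ≤ ρ' := by rw [hρ']
    have hρσ : ((ρ' : ℝ≥0) : WithTop ℝ≥0) ≤ thrSigma κ hA hδ H s ω := by rw [hρ']; exact hlt.le
    have h1 := (tendsto_pieceMart_of_mem_piece hs hclw hlt hρu huσ).1
    have h2 := (tendsto_pieceMart_of_mem_piece hs hclw hlt hρρ hρσ).1
    have hmin : (min (t : WithTop ℝ≥0) (thrRho κ hA hδ H s ω)).untopA = ρ' := by rw [min_eq_right hρt.le, ← hρ']; rfl
    have heq : ∀ n, pieceIncr κ hA hδ H s n t ω = pieceMart κ hA hδ s n u ω - pieceMart κ hA hδ s n ρ' ω := fun n ↦ by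
      simp only [pieceIncr, stoppedProcess, hmin, hudef]
    have htarget : stoppedProcess (thrDrv κ A) (thrSigma κ hA hδ H s) t ω - stoppedProcess (thrDrv κ A) (thrRho κ hA hδ H s) t ω =
        (thrDrv κ A u ω + (starShift (pieceHull A s)).re) - (thrDrv κ A ρ' ω + (starShift (pieceHull A s)).re) := by
      simp only [stoppedProcess, hmin, hudef]; ring
    rw [htarget]
    exact (h1.sub h2).congr fun n ↦ (heq n).symm

/-- **The piece martingale at the start of a nonempty piece converges to `X_{ρ_s} + L_{B_s}`.** [folklore] -/
theorem tendsto_stoppedValue_pieceMart_thrRho (hs : s ⊆ clusterFinset hA hδ)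
    (hclw : ∀ t : ℝ≥0, (t : WithTop ℝ≥0) ≤ H ω → ∀ a ∈ A, deltaCluster A δ a ⊆ closedHull (drvK κ (brownianCPath ω)) t ∨
      Disjoint (deltaCluster A δ a) (closedHull (drvK κ (brownianCPath ω)) t))
    (hlt : thrRho κ hA hδ H s ω < thrSigma κ hA hδ H s ω) :
    Tendsto (fun n ↦ stoppedValue (pieceMart κ hA hδ s n) (thrRho κ hA hδ H s) ω) atTop
      (𝓝 (stoppedValue (thrDrv κ A) (thrRho κ hA hδ H s) ω + (starShift (pieceHull A s)).re)) := by
  obtain ⟨ρ', hρ'⟩ := WithTop.ne_top_iff_exists.1 hlt.ne_top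
  have hρρ : thrRho κ hA hδ H s ω ≤ ρ' := by rw [hρ']
  have hρσ : ((ρ' : ℝ≥0) : WithTop ℝ≥0) ≤ thrSigma κ hA hδ H s ω := by rw [hρ']; exact hlt.le
  have h := (tendsto_pieceMart_of_mem_piece hs hclw hlt hρρ hρσ).1
  have hval : (thrRho κ hA hδ H s ω).untopA = ρ' := by rw [← hρ']; rfl
  simp only [stoppedValue, hval]
  exact h

/-- **The through-swallow clock increment over a piece is the capacity-clock increment of the piece hull**:
for `ρ_s ≤ ρ' ≤ u ≤ σ_s` (nonempty piece), `σ_A(u) − σ_A(ρ') = σ_{B_s}(u) − σ_{B_s}(ρ')`. [folklore] -/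
theorem thrClock_sub_eq_imageClock_sub (hs : s ⊆ clusterFinset hA hδ) (hH : H ω ≠ ⊤)
    (hclw : ∀ t : ℝ≥0, (t : WithTop ℝ≥0) ≤ H ω → ∀ a ∈ A, deltaCluster A δ a ⊆ closedHull (drvK κ (brownianCPath ω)) t ∨
      Disjoint (deltaCluster A δ a) (closedHull (drvK κ (brownianCPath ω)) t))
    (hlt : thrRho κ hA hδ H s ω < thrSigma κ hA hδ H s ω) {ρ' u : ℝ≥0} (hρρ : thrRho κ hA hδ H s ω ≤ ρ') (hρu : ρ' ≤ u)
    (huσ : (u : WithTop ℝ≥0) ≤ thrSigma κ hA hδ H s ω) :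
    thrClock (drvK κ (brownianCPath ω)) A u - thrClock (drvK κ (brownianCPath ω)) A ρ' =
      imageClock (drvK κ (brownianCPath ω)) (pieceHull A s) u - imageClock (drvK κ (brownianCPath ω)) (pieceHull A s) ρ' := by
  set W := drvK κ (brownianCPath ω) with hWdef
  have hWc : Continuous W := continuous_drvK κ _
  set B := pieceHull A s with hBdef
  obtain ⟨hab, hah, hρa⟩ := pieceStart_lt_of_thrRho_lt hlt
  obtain ⟨h, hh⟩ := WithTop.ne_top_iff_exists.1 hH
  have huh : (u : WithTop ℝ≥0) ≤ H ω := huσ.trans (min_le_right _ _)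
  have huh' : u ≤ h := by rw [← hh] at huh; exact WithTop.coe_le_coe.1 huh
  have hub : (u : WithTop ℝ≥0) ≤ hullHitTime W B := (huσ.trans (min_le_left _ _)).trans_eq (pieceEnd_eq_hullHitTime hWc hA hδ hs)
  have haρ : pieceStart W s ≤ ρ' := hρa ▸ hρρ
  -- integrability
  have hclw' : ∀ t : ℝ≥0, t ≤ h → ∀ a ∈ A, deltaCluster A δ a ⊆ closedHull W t ∨ Disjoint (deltaCluster A δ a) (closedHull W t) :=
    fun t ht ↦ hclw t (by rw [← hh]; exact WithTop.coe_le_coe.2 ht)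
  have hintA := integrableOn_thrClockRate_of_clusterwise (κ := κ) hA hδ hclw'
  have h0I : (0 : ℝ) ∈ Icc (0 : ℝ) h := ⟨le_rfl, h.coe_nonneg⟩
  have huI : (u : ℝ) ∈ Icc (0 : ℝ) h := ⟨u.coe_nonneg, by exact_mod_cast huh'⟩
  have hρI : (ρ' : ℝ) ∈ Icc (0 : ℝ) h := ⟨ρ'.coe_nonneg, by exact_mod_cast hρu.trans huh'⟩
  have hiA := fun {x y : ℝ} (hx : x ∈ Icc (0 : ℝ) h) (hy : y ∈ Icc (0 : ℝ) h) ↦ intervalIntegrable_thrClockRate hintA hx hy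
  have hiBu := intervalIntegrable_imageClockRate_of_le_hullHitTime hWc (isStarHull_pieceHull hA hδ hs) hub
  have hiBρ := intervalIntegrable_imageClockRate_of_le_hullHitTime hWc (isStarHull_pieceHull hA hδ hs)
    ((WithTop.coe_le_coe.2 hρu).trans hub)
  rw [thrClock, thrClock, imageClock, imageClock, intervalIntegral.integral_interval_sub_left (hiA h0I huI) (hiA h0I hρI),
    intervalIntegral.integral_interval_sub_left hiBu hiBρ]
  -- the rates agree on `[ρ', u)`
  refine intervalIntegral.integral_congr_ae ?_
  rw [MeasureTheory.ae_iff]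
  refine measure_mono_null (fun r hr ↦ ?_) (measure_singleton (u : ℝ))
  simp only [mem_setOf_eq, Classical.not_imp] at hr
  obtain ⟨hrI, hne⟩ := hr
  rw [uIoc_of_le (by exact_mod_cast hρu : (ρ' : ℝ) ≤ u)] at hrI
  by_contra hru
  refine hne ?_
  have hr0 : 0 ≤ r := ρ'.coe_nonneg.trans hrI.1.le
  have hrlt : (r : ℝ) < u := lt_of_le_of_ne hrI.2 hru
  have h1 : pieceStart W s ≤ r.toNNReal :=
    haρ.trans (WithTop.coe_le_coe.2 (by rw [← NNReal.coe_le_coe, Real.coe_toNNReal _ hr0]; exact hrI.1.le))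
  have h2 : ((r.toNNReal : ℝ≥0) : WithTop ℝ≥0) < (u : WithTop ℝ≥0) := by
    have : r.toNNReal < u := by rw [← NNReal.coe_lt_coe, Real.coe_toNNReal _ hr0]; exact hrlt
    exact_mod_cast this
  have hrem := remHull_eq_pieceHull_of_mem_piece hs hclw h1 (h2.trans_le (huσ.trans (min_le_left _ _))) (h2.le.trans huh)
  rw [thrClockRate_eq_imageClockRate_remHull (rfl : remHull W A r.toNNReal = remHull W A r.toNNReal), hrem]

/-- **The piece clock increment converges to the increment of the through-swallow clock**:
`ΔC^{s,n}_t → σ_A(t ∧ σ_s) − σ_A(t ∧ ρ_s)`. [cite: Lawler2005, §6.3 Thm. 6.13] -/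
theorem tendsto_pieceClockIncr (hs : s ⊆ clusterFinset hA hδ) (hH : H ω ≠ ⊤)
    (hclw : ∀ t : ℝ≥0, (t : WithTop ℝ≥0) ≤ H ω → ∀ a ∈ A, deltaCluster A δ a ⊆ closedHull (drvK κ (brownianCPath ω)) t ∨
      Disjoint (deltaCluster A δ a) (closedHull (drvK κ (brownianCPath ω)) t)) (t : ℝ≥0) :
    Tendsto (fun n ↦ pieceClockIncr κ hA hδ H s n t ω) atTop
      (𝓝 (thrClock (drvK κ (brownianCPath ω)) A ((min (t : WithTop ℝ≥0) (thrSigma κ hA hδ H s ω)).untopA : ℝ≥0) -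
        thrClock (drvK κ (brownianCPath ω)) A ((min (t : WithTop ℝ≥0) (thrRho κ hA hδ H s ω)).untopA : ℝ≥0))) := by
  rcases (thrRho_le_thrSigma (κ := κ) (hA := hA) (hδ := hδ) (H := H) s ω).eq_or_lt with heq | hlt
  · have h1 : ∀ n, pieceClockIncr κ hA hδ H s n t ω = 0 := fun n ↦ by simp only [pieceClockIncr, stoppedProcess, heq, sub_self]
    simp only [h1, heq, sub_self]; exact tendsto_const_nhds
  rcases le_or_gt (t : WithTop ℝ≥0) (thrRho κ hA hδ H s ω) with htρ | hρt
  · have htσ : (t : WithTop ℝ≥0) ≤ thrSigma κ hA hδ H s ω := htρ.trans hlt.le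
    have h1 : ∀ n, pieceClockIncr κ hA hδ H s n t ω = 0 := fun n ↦ by
      simp only [pieceClockIncr, stoppedProcess_eq_of_le htρ, stoppedProcess_eq_of_le htσ, sub_self]
    simp only [h1, min_eq_left htρ, min_eq_left htσ, sub_self]; exact tendsto_const_nhds
  · obtain ⟨ρ', hρ'⟩ := WithTop.ne_top_iff_exists.1 hρt.ne_top
    set u : ℝ≥0 := (min (t : WithTop ℝ≥0) (thrSigma κ hA hδ H s ω)).untopA with hudef
    have hucoe : (u : WithTop ℝ≥0) = min (t : WithTop ℝ≥0) (thrSigma κ hA hδ H s ω) :=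
      Literature.Analysis.FunctionSpaces.coe_untopA_min _ _
    have hρu' : ((ρ' : ℝ≥0) : WithTop ℝ≥0) ≤ u := by rw [hucoe, hρ']; exact le_min hρt.le hlt.le
    have hρu : ρ' ≤ u := WithTop.coe_le_coe.1 hρu'
    have huσ : (u : WithTop ℝ≥0) ≤ thrSigma κ hA hδ H s ω := by rw [hucoe]; exact min_le_right _ _
    have hρρ : thrRho κ hA hδ H s ω ≤ ρ' := by rw [hρ']
    have hρσ : ((ρ' : ℝ≥0) : WithTop ℝ≥0) ≤ thrSigma κ hA hδ H s ω := by rw [hρ']; exact hlt.le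
    have h1 := (tendsto_pieceMart_of_mem_piece hs hclw hlt (hρρ.trans hρu') huσ).2
    have h2 := (tendsto_pieceMart_of_mem_piece hs hclw hlt hρρ hρσ).2
    have hmin : (min (t : WithTop ℝ≥0) (thrRho κ hA hδ H s ω)).untopA = ρ' := by rw [min_eq_right hρt.le, ← hρ']; rfl
    have heq : ∀ n, pieceClockIncr κ hA hδ H s n t ω = pieceClock κ hA hδ s n u ω - pieceClock κ hA hδ s n ρ' ω := fun n ↦ by
      simp only [pieceClockIncr, stoppedProcess, hmin, hudef]
    have htarget : thrClock (drvK κ (brownianCPath ω)) A ((min (t : WithTop ℝ≥0) (thrSigma κ hA hδ H s ω)).untopA : ℝ≥0) -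
        thrClock (drvK κ (brownianCPath ω)) A ((min (t : WithTop ℝ≥0) (thrRho κ hA hδ H s ω)).untopA : ℝ≥0) =
        thrClock (drvK κ (brownianCPath ω)) A u - thrClock (drvK κ (brownianCPath ω)) A ρ' := by
      simp only [hmin, hudef]
    rw [htarget, thrClock_sub_eq_imageClock_sub hs hH hclw hlt hρρ hρu huσ]
    exact (h1.sub h2).congr fun n ↦ (heq n).symm

end Limits

end Literature.Probability.RandomPlanarGeometry

end
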